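import Summits.QuantumFields.YangMills.Theorems.BalabanUVNodesPortS1G3CResolvent
import Summits.QuantumFields.YangMills.Theorems.BalabanUVNodesK0RecordFormatNamesLemmas17
import Summits.QuantumFields.YangMills.Theorems.BalabanUVNodesK0RecordFormatNamesP0C

/-!
# NODE O port PT-A — `stub_G3C` (repaired edition `G3CAtRecordL`), layer (D1): THE X-LOCALIZED OPERATORS `T^{(Z)}(φ) = Σ_{Y ⊆ Z} T_Y(φ)` of a P0-ℂ carrier on the non-`b₀` index, their
# `x`-RESOLVENTS RESTRICTED TO THE INDICES OF `Z` and the LOCAL INVERSES `G_Z(x, φ)` (extension by zero) — with the letters a walk edition needs, from `P0CarrierClauses` ALONE: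
# support, locality (1.7), coercivity transported from (P5ᶜ), invertibility and the x-UNIFORM bound `‖G_Z(x,φ) i j‖ ≤ 1/γ₀`, continuity in `x ≥ 0`

Cell `ym-nodeO-ideate`, porter hand `hand-27930-G3C` (g0); DEFINITION file (objects the repaired line posits: `g3cInDom`, `g3cLocOp`, `g3cLocBlock`, `g3cLocInv`) + their elementary letters;
`--supports stmt-QuantumFields-27930 --as helper`; count-neutral.  [16] = [Balaban1985UV3], [B9] = [Balaban1985BackgroundPropagators], [I] = [Balaban1987RG1].

WHY.  The hand's road for the repaired stub `stub_G3C : ∀ F, G3CAtRecordL F` (✓`…PortS1G3CDefsL`; memo `Cruxes/PortRecordRepresentationS1/Lines/pta_residueW-stub_G3C-hand.md` §5b): the walk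
terms of `Tr (x + T)⁻¹` are products of the sticking-out pieces and of LOCAL INVERSES `G_□ = (x·P_□̃ + T^{(□̃)})⁻¹` on the `5^d` blocks `□̃`; everything field-local lives in the X-localized operators
`T^{(Z)} := Σ_{Y ⊆ Z} T_Y` — EXACTLY the partial sums (P5ᶜ) of `P0CarrierClauses` is stated for.  This file types them at one volume `K` and proves, from the P0-ℂ body only: `T^{(Z)}` is supported
on the indices of `Z` (P4-supp + `domSites` monotone) and reads the pair only on `domSites Z` (P4-loc); its restriction to the indices of `Z` is `Re`-coercive with `γ₀` at every `φ` of the record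
space of `Z` (P5ᶜ, transported to the subtype); hence (✓`…G3CResolvent`) `x·1 + T^{(Z)}|_Z` is a unit for `x ≥ 0`, the local inverse has entries `≤ 1/γ₀` UNIFORMLY in `x ≥ 0`, and is continuous
in `x` on `[0, ∞)` — rows (g3)∕(g5) of `G3CPiecesAt` for the building blocks.  The lattice-scale Combes–Thomas decay of `G_Z` (from (P4-lat)) and the covariance (from (P3)) are the next layer.

WHAT THIS FILE PROVES (sorry-free): `g3cLocOp_apply_eq_zero_left∕right` (support), `g3cLocOp_congr_of_agreeOnSet` + `g3cLocInv_congr_of_agreeOnSet` ((1.7) locality),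
`g3cLocBlock_reCoercive` ((P5ᶜ) on the subtype), `isUnit_det_g3cLocBlock`, `norm_g3cLocInv_apply_le` (`≤ 1/γ₀`, x-uniform), `g3cLocInv_apply_of_not_mem` (support),
`continuousOn_g3cLocInv_apply` (`x ∈ [0, ∞)`).

HONEST FRAMING.  Definitions + elementary letters under the HYPOTHESIS `P0CarrierClauses …` (inhabited nowhere); nothing of Bałaban's estimates asserted, ported or discharged; `stub_G3C` NOT
closed; 27930 OPEN; NODE O 0∕1; COUNT 8∕28 · K 1∕4 UNMOVED; finite `𝕋⁴_{L^K}` at fixed ε — NOT continuum ∕ OS ∕ Clay; **the Yang–Mills mass gap is NOT proved by any of this.**  No `sorry`,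
no `instance`, no `notation`; standard axioms.
-/

noncomputable section

open scoped BigOperators Matrix.Norms.L2Operator Topology Matrix Classical
open Filter Finset

namespace Summit.QuantumFields.YangMills.Theorems.BalabanUVNodesPortS1

open Summit.QuantumFields.YangMills.Theorems.K0RecordFormatNames
open Literature.MathematicalPhysics.QuantumFieldTheory.Balaban1983to89
open Literature.MathematicalPhysics.QuantumFieldTheory.Balaban1983to89.Node00
open Literature.MathematicalPhysics.QuantumFieldTheory.Balaban1983to89.T4Continuum (T4Family)
open Literature.MathematicalPhysics.QuantumFieldTheory.Balaban1983to89.B5Prop11Lower (nsq nsq_nonneg)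

variable (F : T4Family)

/-! ## §1  Definitions at one volume `K` -/

/-- **Index in domain**: the non-`b₀` fluctuation index `i` lies in the localization domain `Z` — its fine representative site is in `domSites Z` (the support vocabulary of (P4)∕(P5ᶜ)).
[cite: Balaban1987RG1, (1.7) p.261, p.257] -/
def g3cInDom (Mc k K : ℕ) (Z : (recordDomSys F Mc k K).Dom) (i : NonB0Idx F k K) : Prop :=
  B15DeterminingSets.embIter k i.1.1.src ∈ Sect2.domSites (F.P K) Mc (k + 1) Z

/-- **The X-localized operator `T^{(Z)}(φ) := Σ_{Y ⊆ Z} T_Y(φ)`** on the non-`b₀` index (the partial sum of (P5ᶜ)). [cite: Balaban1987RG1, (1.7) p.261; Balaban1985UV3, (24) p.262] -/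
def g3cLocOp (Mc k K : ℕ) (TYK : (recordDomSys F Mc k K).Dom → Sect2.CPair (F.P K) (MatA 2) → FluctIdx F k K → FluctIdx F k K → ℂ)
    (Z : (recordDomSys F Mc k K).Dom) (φ : Sect2.CPair (F.P K) (MatA 2)) : Matrix (NonB0Idx F k K) (NonB0Idx F k K) ℂ :=
  Matrix.of fun i j => ∑ Y ∈ (Finset.univ : Finset (recordDomSys F Mc k K).Dom).filter (fun Y => Y.1 ⊆ Z.1), TYK Y φ i.1 j.1

/-- **The restricted `x`-resolvent block `x·1 + T^{(Z)}(φ)|_Z`** on the indices of `Z`. [cite: Balaban1985UV3, p.272 (after (63)); Balaban1985BackgroundPropagators, (3.42) p.399] -/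
def g3cLocBlock (Mc k K : ℕ) (TYK : (recordDomSys F Mc k K).Dom → Sect2.CPair (F.P K) (MatA 2) → FluctIdx F k K → FluctIdx F k K → ℂ)
    (Z : (recordDomSys F Mc k K).Dom) (x : ℝ) (φ : Sect2.CPair (F.P K) (MatA 2)) :
    Matrix {i : NonB0Idx F k K // g3cInDom F Mc k K Z i} {i : NonB0Idx F k K // g3cInDom F Mc k K Z i} ℂ :=
  (x : ℂ) • (1 : Matrix _ _ ℂ) +
    (g3cLocOp F Mc k K TYK Z φ).submatrix (Subtype.val : {i : NonB0Idx F k K // g3cInDom F Mc k K Z i} → NonB0Idx F k K) Subtype.val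

/-- **THE LOCAL INVERSE `G_Z(x, φ)`**: the inverse of `x·1 + T^{(Z)}(φ)|_Z`, extended by zero to the whole non-`b₀` index (print's `G′_□` on `□̃`, [B9] (3.87)).
[cite: Balaban1985BackgroundPropagators, (3.87)–(3.88) p.409; Balaban1985UV3, p.272] -/
def g3cLocInv (Mc k K : ℕ) (TYK : (recordDomSys F Mc k K).Dom → Sect2.CPair (F.P K) (MatA 2) → FluctIdx F k K → FluctIdx F k K → ℂ)
    (Z : (recordDomSys F Mc k K).Dom) (x : ℝ) (φ : Sect2.CPair (F.P K) (MatA 2)) : Matrix (NonB0Idx F k K) (NonB0Idx F k K) ℂ :=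
  fun i j => if hi : g3cInDom F Mc k K Z i then (if hj : g3cInDom F Mc k K Z j then (g3cLocBlock F Mc k K TYK Z x φ)⁻¹ ⟨i, hi⟩ ⟨j, hj⟩ else 0) else 0

/-! ## §2  Support and (1.7) locality (from (P4)) -/

section Letters

variable {F}
variable {a₀ δ₀ c₀ γ₀ γ₁ : ℝ} {Mc : ℕ} {α₀ α₁ ε₂₉ : ℝ} {k : ℕ}
variable {TC : (n : ℕ) → Sect2.CPair (F.P (recordK₀ F Mc k + n)) (MatA 2) → FluctIdx F k (recordK₀ F Mc k + n) → FluctIdx F k (recordK₀ F Mc k + n) → ℂ}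
variable {TY : (n : ℕ) → (recordDomSys F Mc k (recordK₀ F Mc k + n)).Dom → Sect2.CPair (F.P (recordK₀ F Mc k + n)) (MatA 2) →
  FluctIdx F k (recordK₀ F Mc k + n) → FluctIdx F k (recordK₀ F Mc k + n) → ℂ}
variable {TZY : Finset (Fin 4 → ℤ) → IntBondCfg → ((Fin 4 → ℤ) × Fin 4) × Fin 3 → ((Fin 4 → ℤ) × Fin 4) × Fin 3 → ℂ}
variable {AdM : (n : ℕ) → (Site (F.P (recordK₀ F Mc k + n)) 0 → (MatA 2)ˣ) →
  Matrix (FluctIdx F k (recordK₀ F Mc k + n)) (FluctIdx F k (recordK₀ F Mc k + n)) ℂ}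
variable {AdZ : ((Fin 4 → ℤ) → (MatA 2)ˣ) → (Fin 4 → ℤ) × Fin 4 → Matrix (Fin 3) (Fin 3) ℂ}

/-- **Support (left index)**: `T^{(Z)}(φ) i j = 0` unless `i` lies in `Z`. [cite: Balaban1987RG1, (1.7) p.261] -/
theorem g3cLocOp_apply_eq_zero_left (hP : P0CarrierClauses F a₀ δ₀ c₀ γ₀ γ₁ Mc α₀ α₁ ε₂₉ k TC TY TZY AdM AdZ) (n : ℕ)
    (Z : (recordDomSys F Mc k (recordK₀ F Mc k + n)).Dom) (φ : Sect2.CPair (F.P (recordK₀ F Mc k + n)) (MatA 2))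
    {i : NonB0Idx F k (recordK₀ F Mc k + n)} (hi : ¬ g3cInDom F Mc k (recordK₀ F Mc k + n) Z i) (j : NonB0Idx F k (recordK₀ F Mc k + n)) :
    g3cLocOp F Mc k (recordK₀ F Mc k + n) (TY n) Z φ i j = 0 := by
  classical
  obtain ⟨-, -, -, -, -, -, -, -, hSupp, -⟩ := hP
  rw [g3cLocOp, Matrix.of_apply]
  refine Finset.sum_eq_zero fun Y hY => ?_
  rw [Finset.mem_filter] at hY
  exact hSupp n Y φ i.1 j.1 (Or.inl fun h => hi (domSites_subset_of_subset (F.P (recordK₀ F Mc k + n)) Mc (k + 1) hY.2 h))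

/-- **Support (right index)**: `T^{(Z)}(φ) i j = 0` unless `j` lies in `Z`. [cite: Balaban1987RG1, (1.7) p.261] -/
theorem g3cLocOp_apply_eq_zero_right (hP : P0CarrierClauses F a₀ δ₀ c₀ γ₀ γ₁ Mc α₀ α₁ ε₂₉ k TC TY TZY AdM AdZ) (n : ℕ)
    (Z : (recordDomSys F Mc k (recordK₀ F Mc k + n)).Dom) (φ : Sect2.CPair (F.P (recordK₀ F Mc k + n)) (MatA 2))
    (i : NonB0Idx F k (recordK₀ F Mc k + n)) {j : NonB0Idx F k (recordK₀ F Mc k + n)} (hj : ¬ g3cInDom F Mc k (recordK₀ F Mc k + n) Z j) :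
    g3cLocOp F Mc k (recordK₀ F Mc k + n) (TY n) Z φ i j = 0 := by
  classical
  obtain ⟨-, -, -, -, -, -, -, -, hSupp, -⟩ := hP
  rw [g3cLocOp, Matrix.of_apply]
  refine Finset.sum_eq_zero fun Y hY => ?_
  rw [Finset.mem_filter] at hY
  exact hSupp n Y φ i.1 j.1 (Or.inr fun h => hj (domSites_subset_of_subset (F.P (recordK₀ F Mc k + n)) Mc (k + 1) hY.2 h))

/-- **(1.7) LOCALITY of `T^{(Z)}`**: it reads the pair only on `domSites Z`. [cite: Balaban1987RG1, (1.7) p.261] -/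
theorem g3cLocOp_congr_of_agreeOnSet (hP : P0CarrierClauses F a₀ δ₀ c₀ γ₀ γ₁ Mc α₀ α₁ ε₂₉ k TC TY TZY AdM AdZ) (n : ℕ)
    (Z : (recordDomSys F Mc k (recordK₀ F Mc k + n)).Dom) {φ ψ : Sect2.CPair (F.P (recordK₀ F Mc k + n)) (MatA 2)}
    (h : Sect2.agreeOnSet (Sect2.domSites (F.P (recordK₀ F Mc k + n)) Mc (k + 1) Z) φ ψ) :
    g3cLocOp F Mc k (recordK₀ F Mc k + n) (TY n) Z φ = g3cLocOp F Mc k (recordK₀ F Mc k + n) (TY n) Z ψ := by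
  classical
  obtain ⟨-, -, -, -, -, -, -, -, -, hLoc, -⟩ := hP
  ext i j
  simp only [g3cLocOp, Matrix.of_apply]
  refine Finset.sum_congr rfl fun Y hY => ?_
  rw [Finset.mem_filter] at hY
  rw [hLoc n Y φ ψ (Sect2.agreeOnSet_mono (domSites_subset_of_subset (F.P (recordK₀ F Mc k + n)) Mc (k + 1) hY.2) h)]

/-- **(1.7) LOCALITY of the local inverse**: `G_Z(x, ·)` reads the pair only on `domSites Z`. [cite: Balaban1987RG1, (1.7) p.261] -/
theorem g3cLocInv_congr_of_agreeOnSet (hP : P0CarrierClauses F a₀ δ₀ c₀ γ₀ γ₁ Mc α₀ α₁ ε₂₉ k TC TY TZY AdM AdZ) (n : ℕ)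
    (Z : (recordDomSys F Mc k (recordK₀ F Mc k + n)).Dom) (x : ℝ) {φ ψ : Sect2.CPair (F.P (recordK₀ F Mc k + n)) (MatA 2)}
    (h : Sect2.agreeOnSet (Sect2.domSites (F.P (recordK₀ F Mc k + n)) Mc (k + 1) Z) φ ψ) :
    g3cLocInv F Mc k (recordK₀ F Mc k + n) (TY n) Z x φ = g3cLocInv F Mc k (recordK₀ F Mc k + n) (TY n) Z x ψ := by
  ext i j
  simp only [g3cLocInv, g3cLocBlock, g3cLocOp_congr_of_agreeOnSet hP n Z h]

/-- **Support of the local inverse**: `G_Z(x, φ) i j = 0` unless both indices lie in `Z`. [cite: Balaban1985BackgroundPropagators, (3.88) p.409] -/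
theorem g3cLocInv_apply_of_not_mem (Mc k K : ℕ) (TYK : (recordDomSys F Mc k K).Dom → Sect2.CPair (F.P K) (MatA 2) → FluctIdx F k K → FluctIdx F k K → ℂ)
    (Z : (recordDomSys F Mc k K).Dom) (x : ℝ) (φ : Sect2.CPair (F.P K) (MatA 2)) {i j : NonB0Idx F k K}
    (h : ¬ g3cInDom F Mc k K Z i ∨ ¬ g3cInDom F Mc k K Z j) : g3cLocInv F Mc k K TYK Z x φ i j = 0 := by
  unfold g3cLocInv
  rcases h with h | h
  · rw [dif_neg h]
  · by_cases hi : g3cInDom F Mc k K Z i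
    · rw [dif_pos hi, dif_neg h]
    · rw [dif_neg hi]

/-- Entries of the local inverse on the indices of `Z`. [cite: Balaban1985BackgroundPropagators, (3.87) p.409] -/
theorem g3cLocInv_apply_of_mem (Mc k K : ℕ) (TYK : (recordDomSys F Mc k K).Dom → Sect2.CPair (F.P K) (MatA 2) → FluctIdx F k K → FluctIdx F k K → ℂ)
    (Z : (recordDomSys F Mc k K).Dom) (x : ℝ) (φ : Sect2.CPair (F.P K) (MatA 2)) {i j : NonB0Idx F k K}
    (hi : g3cInDom F Mc k K Z i) (hj : g3cInDom F Mc k K Z j) :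
    g3cLocInv F Mc k K TYK Z x φ i j = (g3cLocBlock F Mc k K TYK Z x φ)⁻¹ ⟨i, hi⟩ ⟨j, hj⟩ := by
  unfold g3cLocInv
  rw [dif_pos hi, dif_pos hj]

/-! ## §3  Coercivity transported from (P5ᶜ); invertibility, the x-uniform `1/γ₀` bound, continuity in `x` -/

/-- **(P5ᶜ) ON THE SUBTYPE**: at every pair of the record space of `Z`, the block `T^{(Z)}(φ)|_Z` is `Re`-coercive with constant `γ₀`. [cite: Balaban1985Variational, Thm 1 (E2) p.279; Balaban1987RG1, (2.11) p.267] -/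
theorem g3cLocBlock_reCoercive (hP : P0CarrierClauses F a₀ δ₀ c₀ γ₀ γ₁ Mc α₀ α₁ ε₂₉ k TC TY TZY AdM AdZ) (n : ℕ)
    (Z : (recordDomSys F Mc k (recordK₀ F Mc k + n)).Dom) {φ : Sect2.CPair (F.P (recordK₀ F Mc k + n)) (MatA 2)}
    (hφ : encodeCfg F (recordK₀ F Mc k + n) φ ∈ recordUc F Mc k α₀ α₁ (recordK₀ F Mc k + n) Z)
    (z : {i : NonB0Idx F k (recordK₀ F Mc k + n) // g3cInDom F Mc k (recordK₀ F Mc k + n) Z i} → ℂ) :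
    γ₀ * nsq z ≤ (star z ⬝ᵥ ((g3cLocOp F Mc k (recordK₀ F Mc k + n) (TY n) Z φ).submatrix
      (Subtype.val : {i : NonB0Idx F k (recordK₀ F Mc k + n) // g3cInDom F Mc k (recordK₀ F Mc k + n) Z i} → _) Subtype.val *ᵥ z)).re := by
  classical
  obtain ⟨-, -, -, -, -, -, -, -, -, -, -, -, hCoer⟩ := hP
  -- extend `z` by zero to the whole non-b₀ index
  set v : NonB0Idx F k (recordK₀ F Mc k + n) → ℂ := fun i => if h : g3cInDom F Mc k (recordK₀ F Mc k + n) Z i then z ⟨i, h⟩ else 0 with hv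
  have hv0 : ∀ i, ¬ g3cInDom F Mc k (recordK₀ F Mc k + n) Z i → v i = 0 := fun i h => by rw [hv]; exact dif_neg h
  have hvz : ∀ i : {i : NonB0Idx F k (recordK₀ F Mc k + n) // g3cInDom F Mc k (recordK₀ F Mc k + n) Z i}, v i.1 = z i := fun i => by
    rw [hv]; exact dif_pos i.2
  have h := hCoer n Z φ hφ v (fun i hi => hv0 i hi)
  -- the two sides agree with the subtype expressions
  have e1 : ∑ i, ‖v i‖ ^ 2 = nsq z := by
    rw [nsq, ← Fintype.sum_subtype_add_sum_subtype (fun i => g3cInDom F Mc k (recordK₀ F Mc k + n) Z i) (fun i => ‖v i‖ ^ 2)]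
    rw [Finset.sum_eq_zero (s := (Finset.univ : Finset {i // ¬ g3cInDom F Mc k (recordK₀ F Mc k + n) Z i})) (fun i _ => by rw [hv0 i.1 i.2, norm_zero]; ring), add_zero]
    exact Finset.sum_congr rfl fun i _ => by rw [hvz i]
  have e2 : (∑ i, ∑ j, star (v i) *
      (∑ Y ∈ Finset.univ.filter (fun Y : (recordDomSys F Mc k (recordK₀ F Mc k + n)).Dom => Y.1 ⊆ Z.1), TY n Y φ i.1 j.1) * v j) =
      star z ⬝ᵥ ((g3cLocOp F Mc k (recordK₀ F Mc k + n) (TY n) Z φ).submatrix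
        (Subtype.val : {i : NonB0Idx F k (recordK₀ F Mc k + n) // g3cInDom F Mc k (recordK₀ F Mc k + n) Z i} → _) Subtype.val *ᵥ z) := by
    rw [dotProduct]
    rw [← Fintype.sum_subtype_add_sum_subtype (fun i => g3cInDom F Mc k (recordK₀ F Mc k + n) Z i)]
    rw [Finset.sum_eq_zero (s := (Finset.univ : Finset {i // ¬ g3cInDom F Mc k (recordK₀ F Mc k + n) Z i}))
      (fun i _ => Finset.sum_eq_zero fun j _ => by rw [hv0 i.1 i.2, star_zero, zero_mul, zero_mul]), add_zero]
    refine Finset.sum_congr rfl fun i _ => ?_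
    rw [Pi.star_apply, Matrix.mulVec, dotProduct, Finset.mul_sum, hvz i]
    rw [← Fintype.sum_subtype_add_sum_subtype (fun j => g3cInDom F Mc k (recordK₀ F Mc k + n) Z j)]
    rw [Finset.sum_eq_zero (s := (Finset.univ : Finset {j // ¬ g3cInDom F Mc k (recordK₀ F Mc k + n) Z j}))
      (fun j _ => by rw [hv0 j.1 j.2, mul_zero]), add_zero]
    refine Finset.sum_congr rfl fun j _ => ?_
    rw [hvz j, Matrix.submatrix_apply, g3cLocOp, Matrix.of_apply]
    ring
  rw [← e1, ← e2]
  exact h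

/-- **The restricted resolvent block is a unit** for `x ≥ 0` at every pair of the record space of `Z`. [cite: Balaban1985UV3, p.272 (after (63))] -/
theorem isUnit_det_g3cLocBlock (hP : P0CarrierClauses F a₀ δ₀ c₀ γ₀ γ₁ Mc α₀ α₁ ε₂₉ k TC TY TZY AdM AdZ) (hγ₀ : 0 < γ₀) (n : ℕ)
    (Z : (recordDomSys F Mc k (recordK₀ F Mc k + n)).Dom) {φ : Sect2.CPair (F.P (recordK₀ F Mc k + n)) (MatA 2)}
    (hφ : encodeCfg F (recordK₀ F Mc k + n) φ ∈ recordUc F Mc k α₀ α₁ (recordK₀ F Mc k + n) Z) {x : ℝ} (hx : 0 ≤ x) :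
    IsUnit (g3cLocBlock F Mc k (recordK₀ F Mc k + n) (TY n) Z x φ).det :=
  G3CCT.isUnit_det_realSmul_one_add hγ₀ (g3cLocBlock_reCoercive hP n Z hφ) hx

/-- ★ **THE x-UNIFORM BOUND `‖G_Z(x, φ) i j‖ ≤ 1/γ₀`** (`x ≥ 0`, `φ` in the record space of `Z`; entries off `Z` are `0`). [cite: Balaban1985UV3, p.272 (after (63)); Balaban1987RG1, (1.18) p.263] -/
theorem norm_g3cLocInv_apply_le (hP : P0CarrierClauses F a₀ δ₀ c₀ γ₀ γ₁ Mc α₀ α₁ ε₂₉ k TC TY TZY AdM AdZ) (hγ₀ : 0 < γ₀) (n : ℕ)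
    (Z : (recordDomSys F Mc k (recordK₀ F Mc k + n)).Dom) {φ : Sect2.CPair (F.P (recordK₀ F Mc k + n)) (MatA 2)}
    (hφ : encodeCfg F (recordK₀ F Mc k + n) φ ∈ recordUc F Mc k α₀ α₁ (recordK₀ F Mc k + n) Z) {x : ℝ} (hx : 0 ≤ x)
    (i j : NonB0Idx F k (recordK₀ F Mc k + n)) :
    ‖g3cLocInv F Mc k (recordK₀ F Mc k + n) (TY n) Z x φ i j‖ ≤ 1 / γ₀ := by
  by_cases hi : g3cInDom F Mc k (recordK₀ F Mc k + n) Z i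
  · by_cases hj : g3cInDom F Mc k (recordK₀ F Mc k + n) Z j
    · rw [g3cLocInv_apply_of_mem Mc k _ (TY n) Z x φ hi hj, g3cLocBlock]
      exact G3CCT.norm_resolvent_apply_le_of_reCoercive hγ₀ (g3cLocBlock_reCoercive hP n Z hφ) hx _ _
    · rw [g3cLocInv_apply_of_not_mem Mc k _ (TY n) Z x φ (Or.inr hj), norm_zero]; positivity
  · rw [g3cLocInv_apply_of_not_mem Mc k _ (TY n) Z x φ (Or.inl hi), norm_zero]; positivity

/-- **Continuity in `x ≥ 0`** of every entry of the local inverse at a pair of the record space of `Z` (row (g5) for the building blocks). [cite: Balaban1985UV3, p.272 (after (63))] -/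
theorem continuousOn_g3cLocInv_apply (hP : P0CarrierClauses F a₀ δ₀ c₀ γ₀ γ₁ Mc α₀ α₁ ε₂₉ k TC TY TZY AdM AdZ) (hγ₀ : 0 < γ₀) (n : ℕ)
    (Z : (recordDomSys F Mc k (recordK₀ F Mc k + n)).Dom) {φ : Sect2.CPair (F.P (recordK₀ F Mc k + n)) (MatA 2)}
    (hφ : encodeCfg F (recordK₀ F Mc k + n) φ ∈ recordUc F Mc k α₀ α₁ (recordK₀ F Mc k + n) Z) (i j : NonB0Idx F k (recordK₀ F Mc k + n)) :
    ContinuousOn (fun x : ℝ => g3cLocInv F Mc k (recordK₀ F Mc k + n) (TY n) Z x φ i j) (Set.Ici 0) := by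
  by_cases hi : g3cInDom F Mc k (recordK₀ F Mc k + n) Z i
  · by_cases hj : g3cInDom F Mc k (recordK₀ F Mc k + n) Z j
    · simp only [g3cLocInv_apply_of_mem Mc k _ (TY n) Z _ φ hi hj, g3cLocBlock]
      exact G3CCT.continuousOn_resolvent_apply_of_reCoercive hγ₀ (g3cLocBlock_reCoercive hP n Z hφ) _ _
    · simp only [g3cLocInv_apply_of_not_mem Mc k _ (TY n) Z _ φ (Or.inr hj)]; exact continuousOn_const
  · simp only [g3cLocInv_apply_of_not_mem Mc k _ (TY n) Z _ φ (Or.inl hi)]; exact continuousOn_const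

end Letters

end Summit.QuantumFields.YangMills.Theorems.BalabanUVNodesPortS1

end
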